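import Summits.QuantumFields.BalabanUV.T4Continuum.Spine.NE9.MemoryFromRate

/-!
# T⁴ programme, spine estimate NE9 (node U3, history side) — THE TOWER OF CARRIERS: `T4OutputRate.NE5` and `T4OutputRate.NE9` BY NAME at
# every pair of consecutive run lengths give gen 3's abstract tower hypotheses, hence node U3's coupling bracket with a cutoff-free,
# history-independent majorant and node U6's `Summable δ` — census item of cell `pub-balaban-gaps`, seat ne9 (gen 4), row C27

Cell `pub-balaban-gaps` (YM blitz G2, seat ne9, unit `pub-balaban-gaps-ne9-g4`; record `run/shared/lean/pub/pub-balaban-gaps/ne/NE9.md` §5 row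
C27).  Gen 3's `MemoryFromRate` (row C24) answered ne4's question «is the tower typable on your carriers?» on a BARE SEQUENCE
`F : ℕ → (ℕ → ℝ) → ℝ` with two global hypotheses (`hT` tower rate at every level, `hL` moduli at every level) and left the tower OF CARRIERS
«typable as a structure but NOT defined here».  This file types it and closes the loop BY NAME:
* §1 FINITE TOWERS EXTEND (`extendTower`, `extendModuli`): a tower known only up to a top level `M₀` (rate below `M₀`, moduli up to `M₀`,
  moduli under an AGE PROFILE `G(m − j)`) extends — by shifting histories above the top — to one satisfying `MemoryFromRate`'s GLOBAL
  hypotheses with the same constants and the same age profile (`extendTower_rate`, `extendTower_moduli`, `extendModuli_bound`).  So the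
  global quantifiers of rows C24∕C25 are WITHOUT LOSS.
* §2 THE TOWER OF CARRIERS (`TowerData`): ONE index type of physical localization domains `X` with the run index `r X` at which `X` first
  occurs (scale index `0`) and its tree length `d X`; ONE ambient background type `B` with a closeness gauge; the one-step transports
  `tr k : B → B` (run `k + 1` → run `k`).  Its level-`k` pair carriers `TowerData.level k : T4OutputRate.Carriers` (scale `k − r X`, transport
  `tr k`) are the carriers of record for the runs `k`, `k + 1`; a family `E k` of one-step output functionals of the FULL re-indexed history
  is read on them, run `k + 1`'s unpaired bare coupling entering through `prepend b` — exactly the `∀ b ∈ ]0, γ]` form in which node U2's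
  read-out consumes NE5 (`T4BetaReadOutLipschitz`, `NE4ReadOutSocket.EBfam`).  `TowerNE5` ∕ `TowerNE9` := `T4OutputRate.NE5` ∕ `.NE9` BY NAME
  at every level.
* §3 THE JUNCTION: `rate_of_towerNE5` (one level), `section_tower` (for a run `k`, a background `U` and a domain `X` present in run `k`, the
  section `m ↦ e^{κd(X)}·E (r X + m) · (descended background) X`, extended above `m₀ = k − r X`, satisfies `hT`, `hL` and the age profile —
  the backgrounds BELOW run `k` are the transports `TowerData.descend k U` of `U`, internal to the proof), and the ENDs
  `bracket_le_of_tower_growing` ∕ `bracket_le_of_tower_bounded`: from `TowerNE5` + `TowerNE9` with moduli of at most geometric GROWTH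
  (resp. BOUNDED) and node U2's geometric (resp. first-moment) discrepancy profile,
  `|E k g U X − E k g' U X| ≤ e^{−κd(X)}·b(k − r X)` with `MemoryFromRate`'s cutoff-free majorants `b` BY NAME; `summable_delta_of_tower_growing`:
  the injection `inj K j := b j` dominates every such bracket and has `Summable (T4CauchySum.delta E ρ inj)` — node U6, clause N2 idle.
VERDICT FOR THE ROW (C27): the hypothesis «tower-NE5» of rows C24–C26 IS `T4OutputRate.NE5` for every pair of consecutive run lengths with
the unpaired coupling as a parameter, on an explicit tower of carriers, and nothing more; GIVEN it and NE9's Lipschitz (or, by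
`MemoryFromRateModulus`, Hölder) half with moduli of geometric age-growth, node U3 → U6 closes with NO `FadingMemory` and NO clause N2.
NEUTRAL for the classification (WORK-bound on W1: the functionals `E k` and their moduli are Bałaban's one-step objects, instantiated 0∕1).

HONEST FRAMING: bookkeeping for rung (B)+1 on a FIXED finite four-torus; hypothesis SHAPES over abstract carriers (nothing of Bałaban's
construction is modelled; `TowerData` records unprinted pairing conventions as DATA exactly as `T4OutputRate.Carriers` does); tower-NE5 and
NE9 NOT PRINTED ∕ NOT PROVED; spine PROVED 0∕9 unchanged; NOT UV stability, NOT the continuum limit, NOT infinite volume, NOT a mass gap,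
NOT Clay.  HONEST DEPENDENCY: continuum YM on T⁴ ⇐ BetaPertH ∧ nine spine estimates (0∕9 proved); BetaPertH ⇐ (D1) ∧ (D4) ∧ CAP+tail.

References (TYPES only): [Balaban1987RG1] = T. Bałaban, Commun. Math. Phys. **109** (1987) 249–301, Thm 1 p. 259 (window), (0.24)–(0.25)
p. 257 and (1.18) p. 263 (domains, decay), p. 256∕298 (history dependence).
-/

namespace Summit.QuantumFields.BalabanUV.T4Continuum.NE9.TowerCarriers

open scoped BigOperators
open Finset
open Literature.MathematicalPhysics.QuantumFieldTheory.Balaban1983to89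
open Literature.MathematicalPhysics.QuantumFieldTheory.Balaban1983to89.T4OutputRate
open T4CauchySum (delta)
open Summit.QuantumFields.BalabanUV.T4Continuum.NE9.MemoryFromRate

/-! ## §1 Finite towers extend: the global hypotheses of `MemoryFromRate` are without loss -/

section Extend

variable {W : Set (ℕ → ℝ)}

/-- EXTENSION OF A TOWER ABOVE A TOP LEVEL `M₀` by shifting histories: `F′ m g = F m g` for `m ≤ M₀`, and `F′ m g = F M₀ (g ∘ (· + (m − M₀)))`
above — the levels above the top repeat the top term on the correspondingly aged history. [folklore] -/
def extendTower (M₀ : ℕ) (F : ℕ → (ℕ → ℝ) → ℝ) (m : ℕ) (g : ℕ → ℝ) : ℝ :=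
  if m ≤ M₀ then F m g else F M₀ (fun i => g (i + (m - M₀)))

/-- EXTENSION OF THE MODULI: `Λ′ m = Λ m` for `m ≤ M₀`; above the top, `Λ′ m j = Λ M₀ (j − (m − M₀))` for `j ≥ m − M₀` and `0` for the
`m − M₀` oldest indices (the AGE `m − j` is preserved). [folklore] -/
def extendModuli (M₀ : ℕ) (Λ : ℕ → ℕ → ℝ) (m j : ℕ) : ℝ :=
  if m ≤ M₀ then Λ m j else if m - M₀ ≤ j then Λ M₀ (j - (m - M₀)) else 0

/-- Below the top the extension is the tower. [folklore] -/
theorem extendTower_of_le {M₀ m : ℕ} (F : ℕ → (ℕ → ℝ) → ℝ) (h : m ≤ M₀) (g : ℕ → ℝ) :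
    extendTower M₀ F m g = F m g := by
  simp [extendTower, h]

/-- Above the top the extension is the top term on the aged history. [folklore] -/
theorem extendTower_of_lt {M₀ m : ℕ} (F : ℕ → (ℕ → ℝ) → ℝ) (h : M₀ < m) (g : ℕ → ℝ) :
    extendTower M₀ F m g = F M₀ (fun i => g (i + (m - M₀))) := by
  simp [extendTower, not_le.mpr h]

/-- **THE RATE EXTENDS**: a tower rate `C₅θ^m` at the levels `m < M₀` (`C₅, θ ≥ 0`) becomes a GLOBAL tower rate of the extension (above the
top, consecutive levels of the extension coincide after the shift). [folklore] -/
theorem extendTower_rate {M₀ : ℕ} {F : ℕ → (ℕ → ℝ) → ℝ} {C₅ θ : ℝ} (hC : 0 ≤ C₅) (hθ : 0 ≤ θ)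
    (hT : ∀ m, m < M₀ → ∀ g ∈ W, |F (m + 1) g - F m (fun i => g (i + 1))| ≤ C₅ * θ ^ m) :
    ∀ m, ∀ g ∈ W, |extendTower M₀ F (m + 1) g - extendTower M₀ F m (fun i => g (i + 1))| ≤ C₅ * θ ^ m := by
  intro m g hg
  rcases Nat.lt_or_ge m M₀ with hm | hm
  · rw [extendTower_of_le F (by omega) g, extendTower_of_le F hm.le]
    exact hT m hm g hg
  · have e1 : extendTower M₀ F (m + 1) g = F M₀ (fun i => g (i + (m + 1 - M₀))) :=
      extendTower_of_lt F (by omega) g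
    have e2 : extendTower M₀ F m (fun i => g (i + 1)) = F M₀ (fun i => g (i + (m + 1 - M₀))) := by
      rcases hm.eq_or_lt with h | h
      · subst h
        rw [extendTower_of_le F le_rfl, Nat.add_sub_cancel_left]
      · rw [extendTower_of_lt F h]
        congr 1
        funext i
        show g (i + (m - M₀) + 1) = g (i + (m + 1 - M₀))
        congr 1
        omega
    rw [e1, e2, sub_self, abs_zero]
    positivity

/-- **THE MODULI EXTEND** (cost `Λ m i·ω(|g_i − g'_i|)` for ANY `ω`): moduli at the levels `m ≤ M₀` on a window closed under ageing
`g ↦ g ∘ (· + k)` give GLOBAL moduli `extendModuli M₀ Λ` for the extension. [folklore] -/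
theorem extendTower_moduli {M₀ : ℕ} {F : ℕ → (ℕ → ℝ) → ℝ} {Λ : ℕ → ℕ → ℝ} {ω : ℝ → ℝ}
    (hWs : ∀ g ∈ W, ∀ k : ℕ, (fun i => g (i + k)) ∈ W)
    (hL : ∀ m, m ≤ M₀ → ∀ g ∈ W, ∀ g' ∈ W, |F m g - F m g'| ≤ ∑ i ∈ range m, Λ m i * ω (|g i - g' i|)) :
    ∀ m, ∀ g ∈ W, ∀ g' ∈ W,
      |extendTower M₀ F m g - extendTower M₀ F m g'| ≤
        ∑ i ∈ range m, extendModuli M₀ Λ m i * ω (|g i - g' i|) := by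
  intro m g hg g' hg'
  rcases Nat.lt_or_ge M₀ m with hm | hm
  · rw [extendTower_of_lt F hm, extendTower_of_lt F hm]
    set δ := m - M₀ with hδ
    have hsplit : ∑ i ∈ range m, extendModuli M₀ Λ m i * ω (|g i - g' i|)
        = ∑ i ∈ range M₀, Λ M₀ i * ω (|g (i + δ) - g' (i + δ)|) := by
      rw [range_eq_Ico, ← sum_Ico_consecutive _ (Nat.zero_le δ) (by omega : δ ≤ m),
        sum_eq_zero (fun i hi => ?_), zero_add, sum_Ico_eq_sum_range, show m - δ = M₀ by omega]
      · refine sum_congr rfl fun i _ => ?_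
        have e : extendModuli M₀ Λ m (δ + i) = Λ M₀ i := by
          simp [extendModuli, not_le.mpr hm, ← hδ]
        rw [e, add_comm δ i]
      · have hi' : i < δ := (mem_Ico.mp hi).2
        simp [extendModuli, not_le.mpr hm, ← hδ, not_le.mpr hi']
    rw [hsplit]
    exact hL M₀ le_rfl _ (hWs g hg δ) _ (hWs g' hg' δ)
  · rw [extendTower_of_le F hm, extendTower_of_le F hm]
    refine (hL m hm g hg g' hg').trans (le_of_eq (sum_congr rfl fun i _ => ?_))
    simp [extendModuli, hm]

/-- **THE AGE PROFILE EXTENDS**: moduli at the levels `m ≤ M₀` under a nonnegative age profile `0 ≤ Λ m j ≤ G(m − j)` (`j < m`) give extended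
moduli under the SAME profile at every level — so BOUNDED (`G ≡ C₉`) and GROWING (`G(a) = C₉μ^a`) moduli are inherited. [folklore] -/
theorem extendModuli_bound {M₀ : ℕ} {Λ : ℕ → ℕ → ℝ} {G : ℕ → ℝ} (hG : ∀ a, 0 ≤ G a)
    (hΛ : ∀ m, m ≤ M₀ → ∀ j, j < m → 0 ≤ Λ m j ∧ Λ m j ≤ G (m - j)) :
    ∀ m j, j < m → 0 ≤ extendModuli M₀ Λ m j ∧ extendModuli M₀ Λ m j ≤ G (m - j) := by
  intro m j hj
  unfold extendModuli
  split_ifs with h1 h2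
  · exact hΛ m h1 j hj
  · have h := hΛ M₀ le_rfl (j - (m - M₀)) (by omega)
    rwa [show M₀ - (j - (m - M₀)) = m - j by omega] at h
  · exact ⟨le_rfl, hG _⟩

end Extend

/-! ## §2 The tower of carriers -/

/-- Prepending run `k + 1`'s UNPAIRED bare coupling `b` to a re-indexed history `g` (the coupling re-indexing of `T4OutputRate` §1, GAPS
G-t4-U3-5: run B's step-0 coupling has no partner under `j ↦ j + 1`). [folklore] -/
def prepend (b : ℝ) (g : ℕ → ℝ) : ℕ → ℝ
  | 0 => b
  | i + 1 => g i

/-- `prepend b g 0 = b`. [folklore] -/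
@[simp] theorem prepend_zero (b : ℝ) (g : ℕ → ℝ) : prepend b g 0 = b := rfl

/-- `prepend b g (i + 1) = g i`. [folklore] -/
@[simp] theorem prepend_succ (b : ℝ) (g : ℕ → ℝ) (i : ℕ) : prepend b g (i + 1) = g i := rfl

/-- A history is its oldest coupling prepended to its tail. [folklore] -/
theorem prepend_head_tail (g : ℕ → ℝ) : prepend (g 0) (fun i => g (i + 1)) = g := by
  funext i
  cases i <;> rfl

/-- **TOWER DATA** (UNPRINTED pairing conventions recorded as DATA, as in `T4OutputRate.Carriers`, now for ALL run lengths at once): an index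
type of physical localization domains `X` with `r X` = the run (number of steps from its initial lattice spacing) in which `X` has scale
index `0`, so that in run `k ≥ r X` it has scale index `k − r X` ((0.24)–(0.25) p. 257 of [I]); the tree length `d X ≥ 0` (scale-covariant);
ONE ambient type `B` of backgrounds for all runs (the instancer takes a disjoint union or the finest-lattice configurations, restricted to the
domains of definition) with a closeness gauge (unused by NE5∕NE9, carried for the pair carriers); the one-step background transports
`tr k : B → B`, run `k + 1` → run `k` (one block averaging); printed ingredients: the domains and decay of [Balaban1987RG1] (0.24)–(0.25)
p. 257, (1.18) p. 263 — the pairing itself is NOT printed.  DATA, nothing asserted. [folklore] -/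
structure TowerData where
  /-- index type of physical localization domains -/
  Dom : Type
  /-- the run in which `X` has scale index `0` -/
  r : Dom → ℕ
  /-- tree length of `X` in the units of its own scale -/
  d : Dom → ℝ
  d_nonneg : ∀ X, 0 ≤ d X
  /-- ambient background type, all runs -/
  B : Type
  /-- closeness gauge on backgrounds -/
  gauge : B → B → ℝ
  gauge_nonneg : ∀ U U', 0 ≤ gauge U U'
  /-- background transport run `k + 1` → run `k` -/
  tr : ℕ → B → B

namespace TowerData

/-- The LEVEL-`k` PAIR CARRIERS of the tower: runs `k` (A) and `k + 1` (B) — `T4OutputRate.Carriers` with scale `k − r X`, both background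
slots the ambient type, transport `tr k`. [folklore] -/
def level (T : TowerData) (k : ℕ) : Carriers where
  Dom := T.Dom
  scale := fun X => k - T.r X
  d := T.d
  d_nonneg := T.d_nonneg
  BgA := T.B
  BgB := T.B
  gauge := T.gauge
  gauge_nonneg := T.gauge_nonneg
  transport := T.tr k

/-- Transporting a run-`k` background `s` runs DOWN: `down k U 0 = U`, `down k U (s+1) = tr (k − (s+1)) (down k U s)`. [folklore] -/
def down (T : TowerData) (k : ℕ) (U : T.B) : ℕ → T.B
  | 0 => U
  | s + 1 => T.tr (k - (s + 1)) (down T k U s)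

/-- The DESCENDED BACKGROUNDS of a run-`k` background `U`: `descend k U n` = its transport to run `n ≤ k` (`= U` at `n = k`). [folklore] -/
def descend (T : TowerData) (k : ℕ) (U : T.B) (n : ℕ) : T.B := T.down k U (k - n)

/-- At the top the descended background is `U`. [folklore] -/
theorem descend_top (T : TowerData) (k : ℕ) (U : T.B) : T.descend k U k = U := by
  simp [descend, down]

/-- Coherence: one transport of the level-`(n+1)` descended background is the level-`n` one (`n < k`). [folklore] -/
theorem tr_descend (T : TowerData) {k n : ℕ} (h : n < k) (U : T.B) :
    T.tr n (T.descend k U (n + 1)) = T.descend k U n := by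
  unfold descend
  rw [show k - n = k - (n + 1) + 1 by omega, down, show k - (k - (n + 1) + 1) = n by omega]

end TowerData

/-- **TOWER-NE5 BY NAME**: for EVERY run length `k` and EVERY admissible unpaired bare coupling `b ∈ ]0, γ]` of run `k + 1`,
`T4OutputRate.NE5` on the level-`k` pair carriers for run `k`'s functional and run `k + 1`'s functional with `b` prepended — the form in which
node U2's read-out already consumes NE5 (`T4BetaReadOutLipschitz`'s `∀ b`, `NE4ReadOutSocket`'s `EBfam`).  NOT PRINTED (cell estimate NE5;
print has only the uniformity in the lattice spacing, [Balaban1987RG1] Thm 1 p. 259).  A parametric definition of a proposition, consumed only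
as a hypothesis — NOT a fact, nothing asserted. [folklore] -/
def TowerNE5 (T : TowerData) (E : ℕ → (ℕ → ℝ) → T.B → T.Dom → ℝ) (γ κ θ C₅ : ℝ) : Prop :=
  ∀ k : ℕ, ∀ b : ℝ, 0 < b → b ≤ γ →
    NE5 (C := T.level k) (E k) (fun g U X => E (k + 1) (prepend b g) U X) (Window γ) κ θ C₅

/-- **TOWER-NE9 BY NAME**: `T4OutputRate.NE9` on the level-`k` carriers for run `k`'s functional, every `k`, with ONE scale-covariant
moduli family `Λ` (the Lipschitz half; no `FadingMemory`).  NOT PRINTED (cell estimate NE9; print: [Balaban1987RG1] p. 263 C^∞ in the last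
coupling, p. 298 dependence on the preceding ones).  A parametric definition of a proposition, consumed only as a hypothesis — NOT a fact,
nothing asserted. [folklore] -/
def TowerNE9 (T : TowerData) (E : ℕ → (ℕ → ℝ) → T.B → T.Dom → ℝ) (γ κ : ℝ) (Λ : ℕ → ℕ → ℝ) : Prop :=
  ∀ k : ℕ, NE9 (C := T.level k) (E k) (Window γ) κ Λ

/-! ## §3 The junction: tower-NE5∕NE9 by name ⇒ the abstract tower ⇒ node U3's bracket and node U6 -/

variable (T : TowerData) {E : ℕ → (ℕ → ℝ) → T.B → T.Dom → ℝ}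

/-- ONE LEVEL: tower-NE5 at run `k` with `b = g 0` is the abstract tower rate between runs `k + 1` and `k` at a run-`(k+1)` background and its
transport, rate `θ^{k − r X}`. [folklore] -/
theorem rate_of_towerNE5 {γ κ θ C₅ : ℝ} (h5 : TowerNE5 T E γ κ θ C₅) (k : ℕ) {g : ℕ → ℝ} (hg : g ∈ Window γ)
    (U : T.B) (X : T.Dom) :
    |E (k + 1) g U X - E k (fun i => g (i + 1)) (T.tr k U) X| ≤ C₅ * θ ^ (k - T.r X) * Real.exp (-(κ * T.d X)) := by
  have h : |E k (fun i => g (i + 1)) (T.tr k U) X - E (k + 1) (prepend (g 0) fun i => g (i + 1)) U X| ≤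
      C₅ * θ ^ (k - T.r X) * Real.exp (-(κ * T.d X)) :=
    h5 k (g 0) (hg 0).1 (hg 0).2 _ (shift_mem_window hg) U X
  rw [prepend_head_tail] at h
  rwa [abs_sub_comm]

/-- **THE SECTION OF THE TOWER AT `(k, U, X)`** (`r X ≤ k`): the sequence `m ↦ e^{κd(X)}·E (r X + m) g (descend k U (r X + m)) X`, extended
above `m₀ = k − r X` by §1, satisfies `MemoryFromRate`'s GLOBAL hypotheses — tower rate `C₅θ^m` (from `TowerNE5`), moduli (from `TowerNE9`)
under the same age profile `G` — and its level-`m₀` term is `e^{κd(X)}·E k g U X`.  The descended backgrounds are internal. [folklore] -/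
theorem section_tower {γ κ θ C₅ : ℝ} {Λ : ℕ → ℕ → ℝ} {G : ℕ → ℝ} (hC : 0 ≤ C₅) (hθ : 0 ≤ θ)
    (h5 : TowerNE5 T E γ κ θ C₅) (h9 : TowerNE9 T E γ κ Λ)
    (hG : ∀ a, 0 ≤ G a) (hΛ : ∀ m j, j < m → 0 ≤ Λ m j ∧ Λ m j ≤ G (m - j))
    (k : ℕ) (U : T.B) (X : T.Dom) (hX : T.r X ≤ k) :
    ∃ (F : ℕ → (ℕ → ℝ) → ℝ) (Λ' : ℕ → ℕ → ℝ),
      (∀ g, F (k - T.r X) g = Real.exp (κ * T.d X) * E k g U X) ∧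
      (∀ m, ∀ g ∈ Window γ, |F (m + 1) g - F m (fun i => g (i + 1))| ≤ C₅ * θ ^ m) ∧
      (∀ m, ∀ g ∈ Window γ, ∀ g' ∈ Window γ, |F m g - F m g'| ≤ ∑ i ∈ range m, Λ' m i * |g i - g' i|) ∧
      (∀ m j, j < m → 0 ≤ Λ' m j ∧ Λ' m j ≤ G (m - j)) := by
  set m₀ := k - T.r X with hm₀
  set F₀ : ℕ → (ℕ → ℝ) → ℝ :=
    fun m g => Real.exp (κ * T.d X) * E (T.r X + m) g (T.descend k U (T.r X + m)) X with hF₀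
  have hpos : 0 < Real.exp (κ * T.d X) := Real.exp_pos _
  refine ⟨extendTower m₀ F₀, extendModuli m₀ Λ, fun g => ?_, ?_, ?_,
    extendModuli_bound hG fun m _ j hj => hΛ m j hj⟩
  · rw [extendTower_of_le F₀ le_rfl, hF₀]
    simp only
    rw [show T.r X + m₀ = k by omega, T.descend_top]
  · refine extendTower_rate hC hθ fun m hm g hg => ?_
    have hn : T.r X + m < k := by omega
    have hrate := rate_of_towerNE5 T h5 (T.r X + m) hg (T.descend k U (T.r X + m + 1)) X
    rw [T.tr_descend hn, Nat.add_sub_cancel_left] at hrate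
    have e : F₀ (m + 1) g - F₀ m (fun i => g (i + 1)) = Real.exp (κ * T.d X) *
        (E (T.r X + m + 1) g (T.descend k U (T.r X + m + 1)) X -
          E (T.r X + m) (fun i => g (i + 1)) (T.descend k U (T.r X + m)) X) := by
      rw [hF₀, ← mul_sub]
      rfl
    rw [e, abs_mul, abs_of_pos hpos]
    calc Real.exp (κ * T.d X) * |E (T.r X + m + 1) g (T.descend k U (T.r X + m + 1)) X -
            E (T.r X + m) (fun i => g (i + 1)) (T.descend k U (T.r X + m)) X|
        ≤ Real.exp (κ * T.d X) * (C₅ * θ ^ m * Real.exp (-(κ * T.d X))) :=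
          mul_le_mul_of_nonneg_left hrate hpos.le
      _ = C₅ * θ ^ m := by rw [Real.exp_neg]; field_simp
  · refine extendTower_moduli (ω := fun t => t) (fun g hg kk => fun i => hg (i + kk)) fun m _ g hg g' hg' => ?_
    have h : |E (T.r X + m) g (T.descend k U (T.r X + m)) X - E (T.r X + m) g' (T.descend k U (T.r X + m)) X| ≤
        Real.exp (-(κ * T.d X)) *
          ∑ i ∈ range (T.r X + m - T.r X), Λ (T.r X + m - T.r X) i * |g i - g' i| :=
      h9 (T.r X + m) g hg g' hg' _ X
    rw [Nat.add_sub_cancel_left] at h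
    have e : F₀ m g - F₀ m g' = Real.exp (κ * T.d X) *
        (E (T.r X + m) g (T.descend k U (T.r X + m)) X - E (T.r X + m) g' (T.descend k U (T.r X + m)) X) := by
      rw [hF₀, ← mul_sub]
    rw [e, abs_mul, abs_of_pos hpos]
    calc Real.exp (κ * T.d X) *
          |E (T.r X + m) g (T.descend k U (T.r X + m)) X - E (T.r X + m) g' (T.descend k U (T.r X + m)) X|
        ≤ Real.exp (κ * T.d X) * (Real.exp (-(κ * T.d X)) * ∑ i ∈ range m, Λ m i * |g i - g' i|) :=
          mul_le_mul_of_nonneg_left h hpos.le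
      _ = ∑ i ∈ range m, Λ m i * |g i - g' i| := by
          rw [← mul_assoc, Real.exp_neg, mul_inv_cancel₀ hpos.ne', one_mul]

/-- **END, GROWING MODULI (node U2's geometric regime; clause N2 idle).**  Tower-NE5 + tower-NE9 BY NAME with moduli of at most geometric
GROWTH `0 ≤ Λ m i ≤ C₉μ^{m−i}` (ANY `μ ≥ 1`) + node U2's geometric discrepancy `|g_i − g'_i| ≤ Dθ′^i` (`0 ≤ θ′ ≤ 1`) + `N ≥ 1`: for every run
`k`, background `U` and domain `X` present in run `k` (`m = k − r X` its scale index),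
`|E k g U X − E k g' U X| ≤ e^{−κd(X)}·[2C₅θ^{m∕N}∕(1−θ) + C₉D·(m∕N)·(μθ′^{N−1})^{m∕N}]` — node U3's coupling bracket with a cutoff-free,
history-independent majorant (`MemoryFromRate.bracket_le_of_growing` BY NAME on the section of `section_tower`). [folklore] -/
theorem bracket_le_of_tower_growing {γ κ θ C₅ C₉ μ D θ' : ℝ} {Λ : ℕ → ℕ → ℝ}
    (hC : 0 ≤ C₅) (hθ0 : 0 ≤ θ) (hθ1 : θ < 1) (hμ : 1 ≤ μ) (hD : 0 ≤ D) (hθ'0 : 0 ≤ θ') (hθ'1 : θ' ≤ 1)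
    (h5 : TowerNE5 T E γ κ θ C₅) (h9 : TowerNE9 T E γ κ Λ)
    (hΛ : ∀ m i, i < m → 0 ≤ Λ m i ∧ Λ m i ≤ C₉ * μ ^ (m - i))
    {N : ℕ} (hN : 1 ≤ N) (k : ℕ) (U : T.B) (X : T.Dom) (hX : T.r X ≤ k)
    {g g' : ℕ → ℝ} (hg : g ∈ Window γ) (hg' : g' ∈ Window γ) (hd : ∀ i, |g i - g' i| ≤ D * θ' ^ i) :
    |E k g U X - E k g' U X| ≤ Real.exp (-(κ * T.d X)) *
      (2 * C₅ * θ ^ ((k - T.r X) / N) / (1 - θ) +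
        C₉ * D * ((k - T.r X) / N : ℕ) * (μ * θ' ^ (N - 1)) ^ ((k - T.r X) / N)) := by
  have hC9 : 0 ≤ C₉ := by
    have h10 := hΛ 1 0 Nat.one_pos
    have hμpos : 0 < μ ^ (1 - 0) := pow_pos (by linarith) _
    exact le_of_mul_le_mul_right (by rw [zero_mul]; exact h10.1.trans h10.2) hμpos
  obtain ⟨F, Λ', hF, hT, hL, hΛ'⟩ := section_tower T hC hθ0 h5 h9 (G := fun a => C₉ * μ ^ a)
    (fun a => by positivity) hΛ k U X hX
  have hb := bracket_le_of_growing (W := Window γ) hC hθ0 hθ1 hμ hD hθ'0 hθ'1 (fun g hg => shift_mem_window hg)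
    (fun g hg g' hg' a => mix_mem_window hg hg' a) hT hL hΛ' hg hg' hd hN (k - T.r X)
  rw [hF g, hF g', ← mul_sub, abs_mul, abs_of_pos (Real.exp_pos _)] at hb
  have h2 := (le_div_iff₀' (Real.exp_pos _)).mpr hb
  rwa [div_eq_inv_mul, ← Real.exp_neg] at h2

/-- **END, BOUNDED MODULI ((E33g)'s regime).**  Tower-NE5 + tower-NE9 BY NAME with BOUNDED moduli `0 ≤ Λ m i ≤ C₉` + a discrepancy profile
`|g_i − g'_i| ≤ d_i`: `|E k g U X − E k g' U X| ≤ e^{−κd(X)}·[2C₅θ^{m∕2}∕(1−θ) + C₉·Σ_{i ∈ [m∕2, m)} d_i]`, `m = k − r X`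
(`MemoryFromRate.bracket_le_of_bounded` BY NAME; summable once `d` has a finite first moment, `summable_majorant_bounded`). [folklore] -/
theorem bracket_le_of_tower_bounded {γ κ θ C₅ C₉ : ℝ} {Λ : ℕ → ℕ → ℝ} {d : ℕ → ℝ}
    (hC : 0 ≤ C₅) (hθ0 : 0 ≤ θ) (hθ1 : θ < 1) (hC9 : 0 ≤ C₉)
    (h5 : TowerNE5 T E γ κ θ C₅) (h9 : TowerNE9 T E γ κ Λ)
    (hΛ : ∀ m i, i < m → 0 ≤ Λ m i ∧ Λ m i ≤ C₉)
    (k : ℕ) (U : T.B) (X : T.Dom) (hX : T.r X ≤ k)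
    {g g' : ℕ → ℝ} (hg : g ∈ Window γ) (hg' : g' ∈ Window γ) (hd : ∀ i, |g i - g' i| ≤ d i) :
    |E k g U X - E k g' U X| ≤ Real.exp (-(κ * T.d X)) *
      (2 * C₅ * θ ^ ((k - T.r X) / 2) / (1 - θ) + C₉ * ∑ i ∈ Ico ((k - T.r X) / 2) (k - T.r X), d i) := by
  obtain ⟨F, Λ', hF, hT, hL, hΛ'⟩ := section_tower T hC hθ0 h5 h9 (G := fun _ => C₉) (fun _ => hC9)
    (fun m j hj => hΛ m j hj) k U X hX
  have hb := bracket_le_of_bounded (W := Window γ) hC hθ0 hθ1 (fun g hg => shift_mem_window hg)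
    (fun g hg g' hg' a => mix_mem_window hg hg' a) hT hL (fun m i hi => hΛ' m i hi) hg hg' hd (k - T.r X)
  rw [hF g, hF g', ← mul_sub, abs_mul, abs_of_pos (Real.exp_pos _)] at hb
  have h2 := (le_div_iff₀' (Real.exp_pos _)).mpr hb
  rwa [div_eq_inv_mul, ← Real.exp_neg] at h2

/-- **END-TO-END, NODE U6 (geometric regime).**  Under the hypotheses of `bracket_le_of_tower_growing` with `q = μθ′^{N−1} < 1`, the
CUTOFF-INDEPENDENT injection `inj K j := 2C₅θ^{j∕N}∕(1−θ) + C₉D·(j∕N)·q^{j∕N}` (i) DOMINATES node U3's coupling bracket of EVERY pair of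
histories with node U2's discrepancy, at EVERY domain of EVERY run (`|E k g U X − E k g' U X| ≤ e^{−κd(X)}·inj K (k − r X) ≤ inj K (k − r X)`),
and (ii) has `Summable (T4CauchySum.delta E₀ ρ inj)` for every `0 ≤ E₀`, `0 ≤ ρ < 1` (`MemoryFromRate.summable_delta_of_growing` BY NAME):
node U3 → U6 along the history channel from tower-NE5 + NE9's Lipschitz half BY NAME, NO `FadingMemory`, NO clause N2. [folklore] -/
theorem summable_delta_of_tower_growing {γ κ θ C₅ C₉ μ D θ' : ℝ} {Λ : ℕ → ℕ → ℝ}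
    (hC : 0 ≤ C₅) (hθ0 : 0 ≤ θ) (hθ1 : θ < 1) (hμ : 1 ≤ μ) (hD : 0 ≤ D) (hθ'0 : 0 ≤ θ') (hθ'1 : θ' ≤ 1)
    (hκ : 0 ≤ κ) (h5 : TowerNE5 T E γ κ θ C₅) (h9 : TowerNE9 T E γ κ Λ) (hC9 : 0 ≤ C₉)
    (hΛ : ∀ m i, i < m → 0 ≤ Λ m i ∧ Λ m i ≤ C₉ * μ ^ (m - i))
    {N : ℕ} (hN : 1 ≤ N) (hq1 : μ * θ' ^ (N - 1) < 1) {E₀ ρ : ℝ} (hE : 0 ≤ E₀) (hρ : 0 ≤ ρ) (hρ1 : ρ < 1) :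
    let inj : ℕ → ℕ → ℝ := fun _ j =>
      2 * C₅ * θ ^ (j / N) / (1 - θ) + C₉ * D * (j / N : ℕ) * (μ * θ' ^ (N - 1)) ^ (j / N)
    (∀ (K k : ℕ) (U : T.B) (X : T.Dom), T.r X ≤ k → ∀ g ∈ Window γ, ∀ g' ∈ Window γ,
        (∀ i, |g i - g' i| ≤ D * θ' ^ i) → |E k g U X - E k g' U X| ≤ inj K (k - T.r X)) ∧
      Summable (delta E₀ ρ inj) := by
  intro inj
  have hq0 : 0 ≤ μ * θ' ^ (N - 1) := by positivity
  have hinj0 : ∀ K j, 0 ≤ inj K j := fun K j =>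
    add_nonneg (div_nonneg (by positivity) (by linarith)) (by positivity)
  refine ⟨fun K k U X hX g hg g' hg' hd => ?_, ?_⟩
  · have h := bracket_le_of_tower_growing T hC hθ0 hθ1 hμ hD hθ'0 hθ'1 h5 h9 hΛ hN k U X hX hg hg' hd
    refine h.trans ?_
    have hexp : Real.exp (-(κ * T.d X)) ≤ 1 :=
      Real.exp_le_one_iff.mpr (by have := T.d_nonneg X; nlinarith)
    calc Real.exp (-(κ * T.d X)) * inj K (k - T.r X) ≤ 1 * inj K (k - T.r X) :=
          mul_le_mul_of_nonneg_right hexp (hinj0 K _)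
      _ = inj K (k - T.r X) := one_mul _
  · exact summable_delta_of_growing hC hθ0 hθ1 hC9 hD hq0 hq1 hN hE hρ hρ1 fun K j _ => ⟨hinj0 K j, le_rfl⟩

end Summit.QuantumFields.BalabanUV.T4Continuum.NE9.TowerCarriers
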